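import Mathlib.GroupTheory.SpecificGroups.Dihedral
import Mathlib.Data.ZMod.Basic
import Mathlib.Tactic
import Literature.Combinatorics.Additive.TripleProductProperty
import Literature.Computability.AlgebraicComplexity.CohnUmansTPP
import HarnessLib

/-!
# A TPP triple of type (4,4,5) (volume 80) in `C5 × D10` (order 50)

Contributed by the speedrun lane `tpp`, seat `sr-tpp-search-g10` (2026-08-20); source
`run/shared/lean/speedrun/tpp/sr-tpp-search-g10/conj/C5xD10_tpp_4_4_5.lean` (sha256
`84e98bbbdd835f40e189a5c73e2ff77aea596081440376462e0113817252e473`), restated over the tree definition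
`TripleProductProperty` for the cell `pub-omega` (topic
`Summits/MatrixMultiplication/OmegaCensus`, ruling L5-9).  HONEST FRAMING: one explicit triple checked by `decide`;
a census lower bound, nothing on `ω`.
Dihedral convention = Mathlib's (`r i * sr j = sr (j-i)`, `sr i * sr j = r (j-i)`); independently re-verified from
scratch by the cell's referee (INBOX 2026-08-20T17:49:30Z) for the order-50 and C₇×D₁₀ triples.

Transported from the speedrun-tpp lane census witness on table `AG-50-3` (table sha256 ae565ec2bc833158…,
sets S=[0, 2, 6, 40], T=[0, 7, 20, 45], U=[0, 26, 28, 30, 32]) along the explicit isomorphism `z^a ρ^b ↦ (a, r b)`,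
`z^a σ ρ^b ↦ (a, sr b)`
(z = element 1 central of order 5, ρ = element 3 of order 5 in the derived subgroup, σ = involution 2; homomorphism
checked on all 50² pairs and the TPP re-verified in these coordinates by `py/transport_cxd.py` before this kernel
check).
Seat sr-tpp-search-g10, 2026-08-20.

Tree restyling by the cell `pub-omega` (seat pub-omega-group-g3, 2026-08-20, ruling L5-9 (2)): the lane's tree-ready
file
`CyclicFiveDihedralTenTPP80.lean` (sha256 `6a37b310d3dd45feda65914cdc65806447f7d0ee1113f572298d02bb2399cfb4`) is
landed here in the OmegaCensus house style — no auxiliary definitions (the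
carrier type and the three sets are written out literally in each statement), a docstring on every declaration,
kernel `decide`
(`decide +kernel`) instead of raised heartbeats; the mathematical content and the sets are unchanged.
Framing: lottery ticket; floor = certified bounds/negative ranges.
-/

namespace Summit.MatrixMultiplication.OmegaCensus.CyclicFiveDihedralTenTPP80

open Literature.Computability.AlgebraicComplexity Literature.Combinatorics.Additive

/-- `|Multiplicative (ZMod 5) × DihedralGroup 5| = 50`. [folklore] -/
theorem card_G : Fintype.card (Multiplicative (ZMod 5) × DihedralGroup 5) = 50 := by
  simp [Fintype.card_prod, ZMod.card, DihedralGroup.card]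

/-- **A `(4,4,5)` TPP triple of `Multiplicative (ZMod 5) × DihedralGroup 5`** (volume `80`; kernel `decide`; lane
tpp census witness). [folklore] -/
theorem tpp : TripleProductProperty
      ({(Multiplicative.ofAdd (0 : ZMod 5), DihedralGroup.r (0 : ZMod 5)),
    (Multiplicative.ofAdd (0 : ZMod 5), DihedralGroup.sr (0 : ZMod 5)),
    (Multiplicative.ofAdd (1 : ZMod 5), DihedralGroup.r (1 : ZMod 5)),
    (Multiplicative.ofAdd (1 : ZMod 5), DihedralGroup.sr (4 : ZMod 5))} :
        Finset (Multiplicative (ZMod 5) × DihedralGroup 5))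
      ({(Multiplicative.ofAdd (0 : ZMod 5), DihedralGroup.r (0 : ZMod 5)),
    (Multiplicative.ofAdd (0 : ZMod 5), DihedralGroup.sr (1 : ZMod 5)),
    (Multiplicative.ofAdd (2 : ZMod 5), DihedralGroup.r (2 : ZMod 5)),
    (Multiplicative.ofAdd (2 : ZMod 5), DihedralGroup.sr (4 : ZMod 5))} :
        Finset (Multiplicative (ZMod 5) × DihedralGroup 5))
      ({(Multiplicative.ofAdd (0 : ZMod 5), DihedralGroup.r (0 : ZMod 5)),
    (Multiplicative.ofAdd (4 : ZMod 5), DihedralGroup.r (1 : ZMod 5)),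
    (Multiplicative.ofAdd (3 : ZMod 5), DihedralGroup.r (2 : ZMod 5)),
    (Multiplicative.ofAdd (2 : ZMod 5), DihedralGroup.r (3 : ZMod 5)),
    (Multiplicative.ofAdd (1 : ZMod 5), DihedralGroup.r (4 : ZMod 5))} :
        Finset (Multiplicative (ZMod 5) × DihedralGroup 5)) := by
  unfold TripleProductProperty; decide +kernel

/-- `Multiplicative (ZMod 5) × DihedralGroup 5` realizes `⟨4,4,5⟩` (Cohn–Umans right-quotient TPP, the tree's
`RealizesTPP`). [folklore] -/
theorem realizesTPP_4_4_5 : RealizesTPP (Multiplicative (ZMod 5) × DihedralGroup 5) 4 4 5 :=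
  ⟨_, _, _, by decide +kernel, by decide +kernel, by decide +kernel, tpp⟩

/-- The volume exceeds `4|G|/3`: `4 · 50 < 3 · 80`. [folklore] -/
theorem volume_gt : 4 * Fintype.card (Multiplicative (ZMod 5) × DihedralGroup 5) < 3 * (4 * 4 * 5) := by
  rw [card_G]; norm_num

end Summit.MatrixMultiplication.OmegaCensus.CyclicFiveDihedralTenTPP80
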